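/-
COR-CM (cells pub-hodgecm / pub-hodgecm2, stage 2 of the Hodge ladder) — TRANSPOSITION SURGE, item (vi) sub-binder S2, TEAM hComp, CARRIERS-PLAN v1.2
§3 S5 («optional `…AtC0` twins», hcomp-lead C1): the closed `hComp` / `hReach` terms of `Transposition/Item6PinReachClosed.lean` (pin-1,
p311503) with the POSITED Appendix-C carrier binder `C` INSTANTIATED at the total term `Model.sec42DataOf h iso`
(`HComp/Sec42DataOf.lean`, v3: NO Albanese hypothesis — [Liu2021] §2.1 Prop. 2.2 is hcomp-abcm-1's THEOREM `Albanese.nonempty_of_numberField`)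
— `C` disappears from the hypothesis list with NO new hypothesis.  Seat prover-pub-hodgecm2-pin-1-g3-0 (pin-1 gen 3, owner of record of `hComp`).  THEOREMS ONLY (two
one-line applications); nothing landed is edited or restated; the END display (S7) is NOT re-cut here.  FRAMING: HC_CM is NOT proved;
S2 is NOT closed.
-/
import Summits.HodgeConjecture.CorCM.B01.Transposition.Item6PinReachClosed
import Summits.HodgeConjecture.CorCM.B01.Transposition.HComp.Sec42DataOf
import HarnessLib

/-!
# Item (vi) S2: `hComp` and `hReach` at the honest datum WITH THE CARRIER `C` INSTANTIATED (`C := Model.sec42DataOf h iso`)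

`Model.hComp_holds` / `Model.pinReach_closed` (p311503) take Liu's §4.2 standing data as a posited Π-binder
`C : ∀ F ι₁ V Φ, Sec42Data (honestP5Of h F ι₁ V Φ) (iso F ι₁ V Φ)`.  pin-1's `Model.sec42DataOf h iso` (CARRIERS-PLAN S5, v3) is a TOTAL
term of that type: at every face the statements read (`6 ≤ [F:ℚ]`) it is EXPLICITLY Prop. C.5's system on Deligne's canonical models
(`honestSystemOf h`), Def. C.8 in the Compact Case (`compactifiedOf`, `X_K = Sh(𝕍)_K`) and `A_K := Alb_{X_K}` chosen inside hcomp-abcm-1's existence THEOREM (`Liu2021/AlbaneseExistence.lean`); at `[F:ℚ] = 2` (read by nothing) the punctured-branch inhabitant.  Instantiating BY APPLICATION: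

* `Model.hComp_holds_atC0 (h) (hA) (iso) (R)` := `hComp_holds h hA iso (sec42DataOf h iso) R`;
* `Model.pinReach_closed_atC0 (h₁ h₃) (h) (hA) (iso) (R)` := `pinReach_closed h₁ h₃ h hA iso (sec42DataOf h iso) R`.

Hypotheses afterwards: the cites `h : exists_recordSystem` ([Deligne1979] 2.2.5) and `hA : albanese_baseChange_isLimit_fan_jacobian`
([Liu2021] §2.1 + FGA) EXACTLY as in `Item6PinReachClosed.lean` — ONE Albanese-class binder, no `exists_albanese` (a theorem on this
path); the parameter `iso`; the rest `R : ∀ F ι₁ V Φ, Thm418Rest (sec42DataOf …)`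
of Thm. 4.18's data (X3 lineage); `h₁ h₃` for the reach statement.  STRENGTH: as `Item6PinReachClosed.lean`; what moved is that `C` is
no longer posited — `Hom_E(A_K, A_μ)_ℚ` now refers to the Albanese of the canonical model's `X_K = Sh(𝕍)_K`.  T5: binders {`h`, `hA`} (+ data) = `Item6PinReachClosed.lean`'s set (CARRY class)
 — line requested on the filed sha.  HC_CM is NOT proved.
-/

noncomputable section

namespace Summit.HodgeConjecture.CorCM.Model

open CategoryTheory CategoryTheory.Limits AlgebraicGeometry NumberField
open Literature.AlgebraicGeometry.Motives
open Literature.AlgebraicGeometry.ShimuraVarieties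
open Literature.AlgebraicGeometry.ShimuraVarieties.UnitaryCanonicalModel
open Literature.NumberTheory.Automorphic
open Literature.NumberTheory.Automorphic.PicardCM
open Literature.NumberTheory.Automorphic.Liu2021
open Literature.NumberTheory.Automorphic.Liu2021.AppendixC

/-- **`hComp` HOLDS at the honest datum WITH `C := Model.sec42DataOf h iso`** (`P5 := Model.honestP5Of h`, pin `ῑ₁ := conj ∘ ι₁`):
the conclusion of `Model.hComp_holds` with the posited §4.2 carrier binder INSTANTIATED at pin-1's total term — at every face read
(`6 ≤ [F:ℚ]`) Prop. C.5's system on Deligne's canonical models, Def. C.8 in the Compact Case (`X_K = Sh(𝕍)_K`), `A_K := Alb_{X_K}` from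
hcomp-abcm-1's theorem ([Liu2021] §2.1 Prop. 2.2, proved).  Remaining hypotheses: the cites `h` ([Deligne1979] 2.2.5, Cor. 2.7.21) and `hA`
([Liu2021] §2.1 + FGA VI 3.3 (iii)) as in `hComp_holds`; the parameter `iso`; the rest `R` of Thm. 4.18's data.  `hComp_holds h hA iso (sec42DataOf h iso) R`.
HC_CM is NOT proved. [cite: Deligne1979ShimuraVarieties, §2.1.2, 2.2.5 and Cor. 2.7.21]
[cite: Liu2021, §2.1 Prop. 2.2 (FJcycle.tex l. 1190–1200), Def. 2.3 (l. 1202–1208), Prop. C.5 l. 4627–4633, §4.2 l. 2053–2074] -/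
theorem hComp_holds_atC0 (h : exists_recordSystem) (hA : albanese_baseChange_isLimit_fan_jacobian)
    (iso : ∀ (F : CMField) (ι₁ : F →+* ℂ) (_ : HermSpace3 F ι₁) (_ : CMType F), ℕ → Prop)
    (R : ∀ (F : CMField) (ι₁ : F →+* ℂ) (V : HermSpace3 F ι₁) (Φ : CMType F), Thm418Rest (sec42DataOf h iso F ι₁ V Φ)) :
    ∀ (F : CMField), IsGalois ℚ F → 6 ≤ Module.finrank ℚ F → ∀ (Φ : CMType F) (ι₁ : F →+* ℂ), ι₁ ∈ Φ.1 →
    ∀ V : HermSpace3 F ι₁, ∃ Ksm : Subgroup (toThm418Data (sec42DataOf h iso F ι₁ V Φ) (R F ι₁ V Φ)).G, IsOpenCompact Ksm ∧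
      ∀ K : Subgroup (toThm418Data (sec42DataOf h iso F ι₁ V Φ) (R F ι₁ V Φ)).G, IsOpenCompact K → K ≤ Ksm →
        ∃ (Cset : Type) (_ : Fintype Cset) (X : Cset → SchemeOver ℂ) (B : ∀ c, UnitaryBallUniformisationDatum 2 (X c))
          (Γ : Cset → Level V) (𝒥 : ∀ c, Jacobian (X c))
          (π : ∀ c, (letI := ((starRingEnd ℂ).comp ι₁).toAlgebra; ((sec42DataOf h iso F ι₁ V Φ).A ((sec42DataOf h iso F ι₁ V Φ).levelOf K)).baseChange ℂ) ⟶ (𝒥 c).J),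
          (∀ c, (B c).Hℂ = V.Hm.map ι₁) ∧
          (∀ c, (B c).Γ.map (Matrix.GeneralLinearGroup.map (B c).τ₁) =
            (Γ c).Γ.map (Matrix.GeneralLinearGroup.map ι₁)) ∧
          Nonempty (IsLimit (Fan.mk (letI := ((starRingEnd ℂ).comp ι₁).toAlgebra; ((sec42DataOf h iso F ι₁ V Φ).A ((sec42DataOf h iso F ι₁ V Φ).levelOf K)).baseChange ℂ) π)) :=
  hComp_holds h hA iso (sec42DataOf h iso) R

/-- **`hReach` CLOSED at the honest datum WITH `C := Model.sec42DataOf h iso`** (`U = picardCMUniverse hHD hI h₁ h₃`): the conclusion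
of `Model.pinReach_closed` (own-htheta's binder `hReach` at `D F ι₁ V Φ := toThm418Data (sec42DataOf h iso F ι₁ V Φ) (R F ι₁ V Φ)`, pin
`A_μ ⊗_{E,ῑ₁} ℂ`) with Liu's `Sh(𝕍)_K = X_K`, `A_K` the CONSTRUCTED ones (canonical models + Compact-Case compactification + the Albanese
existence THEOREM), from the cites `h`, `hA` (as in `pinReach_closed`), the parameter `iso`, the rest `R` of Thm. 4.18's data and the universe records `h₁`/`h₃`.
`pinReach_closed h₁ h₃ h hA iso (sec42DataOf h iso) R`.  HC_CM is NOT proved.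
[cite: Liu2021, Thm. 4.18 (1) (FJcycle.tex l. 2239), §4.2 l. 2053–2074, Def. 4.5 (2) l. 1944, Prop. C.5 l. 4627–4633, §2.1 Prop. 2.2 l. 1190–1200]
[cite: Deligne1979ShimuraVarieties, §2.1.2, 2.2.5 and Cor. 2.7.21] -/
theorem pinReach_closed_atC0
    (h₁ : BallQuotientUniformised) (h₃ : CMAbelianVarietyRealised)
    (h : exists_recordSystem) (hA : albanese_baseChange_isLimit_fan_jacobian)
    (iso : ∀ (F : CMField) (ι₁ : F →+* ℂ) (_ : HermSpace3 F ι₁) (_ : CMType F), ℕ → Prop)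
    (R : ∀ (F : CMField) (ι₁ : F →+* ℂ) (V : HermSpace3 F ι₁) (Φ : CMType F), Thm418Rest (sec42DataOf h iso F ι₁ V Φ)) :
    ∀ (F : CMField), IsGalois ℚ F → 6 ≤ Module.finrank ℚ F → ∀ (Φ : CMType F) (ι₁ : F →+* ℂ), ι₁ ∈ Φ.1 →
      ∀ V : HermSpace3 F ι₁, ∃ Ksm : Subgroup (toThm418Data (sec42DataOf h iso F ι₁ V Φ) (R F ι₁ V Φ)).G, IsOpenCompact Ksm ∧
        ∀ (K : Subgroup (toThm418Data (sec42DataOf h iso F ι₁ V Φ) (R F ι₁ V Φ)).G) (Dμ : (toThm418Data (sec42DataOf h iso F ι₁ V Φ) (R F ι₁ V Φ)).Obj)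
          (φ : (toThm418Data (sec42DataOf h iso F ι₁ V Φ) (R F ι₁ V Φ)).HomK K Dμ),
          IsOpenCompact K → K ≤ Ksm → φ ≠ 0 →
            ∃ (Γ : Level V) (𝒥 : Jacobian (Var.scheme (ballQuotientUniformisedDatum_of h₁) h₃ (.pms (pmsCode F ι₁ V Γ))))
              (w : 𝒥.J ⟶ (letI := ((starRingEnd ℂ).comp ι₁).toAlgebra; ((R F ι₁ V Φ).Aμ Dμ).baseChange ℂ)), w ≠ 0 :=
  pinReach_closed h₁ h₃ h hA iso (sec42DataOf h iso) R

end Summit.HodgeConjecture.CorCM.Model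

end
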